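import Literature.Computability.Cryptography.LWEPrimePowerProgOps
import HarnessLib

/-!
# The Micciancio–Peikert machine, III: the estimation queries on lists

Topic `Computability/Cryptography` (LWE), grouping namespace `LWE.MP12.Prog`, sequel of
`LWEPrimePowerProgOps.lean`. Proved material (no named fact) towards
`Literature.Computability.Cryptography.blprs_gapSVP_sqrt_dim_to_lwe_classical` (**pqc.S21**),
hypothesis `h₂`: the estimation query of level `j`, repetition `k` assembled from the raw input
samples and the coin string at the list level — sum `K` consecutive samples of the unit, add the
level scalar times `2^{e-j}`, shift by the unit's `d` shift scalars, and cut the call's coin slice —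
`estQueryL`, with its polynomial-time realisation on codes **`codeFP_estQueryL`** (one string function
for all dimensions: the parameter tuple, the unary copies of `d`, `K`, `e`, the samples, the coins and
`(j, k)` are its input).

## References

* D. Micciancio, C. Peikert, *Trapdoors for lattices: simpler, tighter, faster, smaller*, EUROCRYPT 2012,
  LNCS 7237; full version IACR ePrint 2011/501, §3, Thm. 3.1 proof (p. 15). [MicciancioPeikert2012]
* S. Arora, B. Barak, *Computational Complexity: A Modern Approach*, CUP 2009, §1.3. [AroraBarak2009]
-/

namespace Literature.Computability.Cryptography

namespace LWE

namespace MP12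

namespace Prog

open _root_.Computability Polynomial Literature.Computability.Complexity Literature.Computability.Complexity.CodeFP

/-- The parameter tuple's type `(d, e, Q, m, K, invGap, T, N, N', m', ℓ)`. [folklore] -/
abbrev PrmT : Type := ℕ × ℕ × ℕ × ℕ × ℕ × ℕ × ℕ × ℕ × ℕ × ℕ × ℕ

/-- Its code. [folklore] -/
abbrev prmE : PrmT → List Bool :=
  pairE natE (pairE natE (pairE natE (pairE natE (pairE natE (pairE natE (pairE natE (pairE natE (pairE natE (pairE natE natE)))))))))

namespace PrmT

variable (P : PrmT)
/-- Dimension. [folklore] -/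
abbrev d : ℕ := P.1
/-- Exponent of the modulus. [folklore] -/
abbrev e : ℕ := P.2.1
/-- Modulus. [folklore] -/
abbrev Q : ℕ := P.2.2.1
/-- Block size. [folklore] -/
abbrev m : ℕ := P.2.2.2.1
/-- Aggregation. [folklore] -/
abbrev K : ℕ := P.2.2.2.2.1
/-- Inverse accuracy. [folklore] -/
abbrev G : ℕ := P.2.2.2.2.2.1
/-- Trials. [folklore] -/
abbrev T : ℕ := P.2.2.2.2.2.2.1
/-- Calls per estimate. [folklore] -/
abbrev N : ℕ := P.2.2.2.2.2.2.2.1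
/-- Measurements per level. [folklore] -/
abbrev N' : ℕ := P.2.2.2.2.2.2.2.2.1
/-- Top samples. [folklore] -/
abbrev m' : ℕ := P.2.2.2.2.2.2.2.2.2.1
/-- Coins per call. [folklore] -/
abbrev ℓ : ℕ := P.2.2.2.2.2.2.2.2.2.2

end PrmT

/-! ### The parameter projections on codes -/

section PrmProj

/-- `d` on codes. [folklore] -/
theorem codeFP_prm_d : CodeFP prmE natE PrmT.d := fst _ _
/-- `e` on codes. [folklore] -/
theorem codeFP_prm_e : CodeFP prmE natE PrmT.e := (snd _ _).fst'
/-- `Q` on codes. [folklore] -/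
theorem codeFP_prm_Q : CodeFP prmE natE PrmT.Q := (snd _ _).snd'.fst'
/-- `m` on codes. [folklore] -/
theorem codeFP_prm_m : CodeFP prmE natE PrmT.m := (snd _ _).snd'.snd'.fst'
/-- `K` on codes. [folklore] -/
theorem codeFP_prm_K : CodeFP prmE natE PrmT.K := (snd _ _).snd'.snd'.snd'.fst'
/-- `G` on codes. [folklore] -/
theorem codeFP_prm_G : CodeFP prmE natE PrmT.G := (snd _ _).snd'.snd'.snd'.snd'.fst'
/-- `T` on codes. [folklore] -/
theorem codeFP_prm_T : CodeFP prmE natE PrmT.T := (snd _ _).snd'.snd'.snd'.snd'.snd'.fst'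
/-- `N` on codes. [folklore] -/
theorem codeFP_prm_N : CodeFP prmE natE PrmT.N := (snd _ _).snd'.snd'.snd'.snd'.snd'.snd'.fst'
/-- `N'` on codes. [folklore] -/
theorem codeFP_prm_N' : CodeFP prmE natE PrmT.N' := (snd _ _).snd'.snd'.snd'.snd'.snd'.snd'.snd'.fst'
/-- `m'` on codes. [folklore] -/
theorem codeFP_prm_m' : CodeFP prmE natE PrmT.m' := (snd _ _).snd'.snd'.snd'.snd'.snd'.snd'.snd'.snd'.fst'
/-- `ℓ` on codes. [folklore] -/
theorem codeFP_prm_ℓ : CodeFP prmE natE PrmT.ℓ := (snd _ _).snd'.snd'.snd'.snd'.snd'.snd'.snd'.snd'.snd'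

end PrmProj

/-- The number of uniform scalars (the list-level twin of `numScalars`). [folklore] -/
def numScalarsL (P : PrmT) : ℕ :=
  (P.e + 1) * (P.N' * P.m) + ((P.e + 1) * (P.N' * P.d) +
    (P.d * (P.e * (2 * (P.T * (P.N * P.m)))) + (P.d * (P.e * (2 * (P.T * (P.N * P.m)))) + (P.d * (P.e * (2 * (P.T * (P.N * P.m)))) +
      (P.d * (P.e * (2 * (P.T * (P.N * P.m)))) + (P.d * (P.e * (2 * (P.T * (P.N * P.m)))) + P.d * (P.e * (2 * (P.T * P.d)))))))))

/-- `numScalarsL` on codes. [cite: AroraBarak2009, §1.3] -/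
theorem codeFP_numScalarsL : CodeFP prmE natE numScalarsL := by
  have hd := codeFP_prm_d
  have he := codeFP_prm_e
  have hm := codeFP_prm_m
  have hT := codeFP_prm_T
  have hN := codeFP_prm_N
  have hN' := codeFP_prm_N'
  have he1 : CodeFP prmE natE (fun P => P.e + 1) := natAdd.comp (he.pair (const _ 1))
  have hX : CodeFP prmE natE (fun P => P.d * (P.e * (2 * (P.T * (P.N * P.m))))) :=
    natMul.comp (hd.pair (natMul.comp (he.pair (natMul.comp ((const _ 2).pair (natMul.comp (hT.pair (natMul.comp (hN.pair hm)))))))))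
  have hTau : CodeFP prmE natE (fun P => P.d * (P.e * (2 * (P.T * P.d)))) :=
    natMul.comp (hd.pair (natMul.comp (he.pair (natMul.comp ((const _ 2).pair (natMul.comp (hT.pair hd)))))))
  exact (natAdd.comp ((natMul.comp (he1.pair (natMul.comp (hN'.pair hm)))).pair
    (natAdd.comp ((natMul.comp (he1.pair (natMul.comp (hN'.pair hd)))).pair
      (natAdd.comp (hX.pair (natAdd.comp (hX.pair (natAdd.comp (hX.pair (natAdd.comp (hX.pair (natAdd.comp (hX.pair hTau)))))))))))))).congr
    fun P => rfl

/-! ### The estimation query, piece by piece -/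

/-- The groups of `K` raw samples of unit `jk` (`m` of them). [folklore] -/
def estGroups (P : PrmT) (Ku : ℕ) (items : List LItem) (jk : ℕ) : List (List LItem) :=
  chunks Ku (sliceAt items (jk * (P.m * P.K)) (P.m * P.K))

/-- `estGroups` on codes: context `((P, 1ᴷ), (items, jk))`. [cite: AroraBarak2009, §1.3] -/
theorem codeFP_estGroups : CodeFP (pairE (pairE prmE unE) (pairE (rawE itemE) natE)) (rawE (rawE itemE))
    (fun z => estGroups z.1.1 z.1.2 z.2.1 z.2.2) := by
  have hP : CodeFP (pairE (pairE prmE unE) (pairE (rawE itemE) natE)) prmE (fun z => z.1.1) := (fst _ _).fst'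
  have hmK : CodeFP (pairE (pairE prmE unE) (pairE (rawE itemE) natE)) natE (fun z => z.1.1.m * z.1.1.K) :=
    natMul.comp ((codeFP_prm_m.comp hP).pair (codeFP_prm_K.comp hP))
  exact ((codeFP_chunks itemE).comp ((fst _ _).snd'.pair ((codeFP_sliceAt itemE).comp ((snd _ _).fst'.pair
    ((natMul.comp ((snd _ _).snd'.pair hmK)).pair hmK))))).congr fun _ => rfl

/-- The representative of the level multiplier `2^{e-j}` (unary cap `eu` of `e`). [folklore] -/
def genAt (P : PrmT) (eu j : ℕ) : ℕ := 2 ^ min (P.e - j) eu % max P.Q 1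

/-- `genAt` on codes: context `((P, 1ᵉ), j)`. [cite: AroraBarak2009, §1.3] -/
theorem codeFP_genAt : CodeFP (pairE (pairE prmE unE) natE) natE (fun z => genAt z.1.1 z.1.2 z.2) :=
  (natMod.comp ((natPow.comp ((const _ 2).pair (unOfNatMin.comp ((fst _ _).snd'.pair (natSub.comp ((codeFP_prm_e.comp (fst _ _).fst').pair (snd _ _))))))).pair
    (natMax.comp ((codeFP_prm_Q.comp (fst _ _).fst').pair (const _ 1))))).congr fun _ => rfl

/-- The `i`-th item of the estimation block: aggregate the group, add the level scalar times the
multiplier. [cite: MicciancioPeikert2012, Thm. 3.1 proof (p. 15)] -/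
def estItemL (P : PrmT) (du : ℕ) (r : List Bool) (jk gen i : ℕ) (grp : List LItem) : LItem :=
  addB P.Q (aggItem P.Q du grp) (scalarAt r P.e (jk * P.m + i) * gen)

/-- The context `(((P, 1ᵈ), (r, (jk, gen))), (i, grp))`. [folklore] -/
abbrev EstItemCtx : Type := ((PrmT × ℕ) × (List Bool × (ℕ × ℕ))) × (ℕ × List LItem)

/-- `estItemL` on codes. [cite: AroraBarak2009, §1.3] -/
theorem codeFP_estItemL : CodeFP (pairE (pairE (pairE prmE unE) (pairE strE (pairE natE natE))) (pairE natE (rawE itemE))) itemE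
    (fun t : EstItemCtx => estItemL t.1.1.1 t.1.1.2 t.1.2.1 t.1.2.2.1 t.1.2.2.2 t.2.1 t.2.2) := by
  have hP : CodeFP (pairE (pairE (pairE prmE unE) (pairE strE (pairE natE natE))) (pairE natE (rawE itemE))) prmE
      (fun t => t.1.1.1) := (fst _ _).fst'.fst'
  have hQ := codeFP_prm_Q.comp hP
  have hagg := codeFP_aggItem.comp ((hQ.pair (fst _ _).fst'.snd').pair (snd _ _).snd')
  have hsc := codeFP_scalarAt.comp ((fst _ _).snd'.fst'.pair ((codeFP_prm_e.comp hP).pair (natAdd.comp ((natMul.comp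
    ((fst _ _).snd'.snd'.fst'.pair (codeFP_prm_m.comp hP))).pair (snd _ _).fst'))))
  exact (codeFP_addB.comp (hQ.pair (hagg.pair (natMul.comp (hsc.pair (fst _ _).snd'.snd'.snd'))))).congr fun _ => rfl

/-- The shift scalars of unit `jk`. [cite: RegevLWE2009, §4 (proof of Lemma 4.1)] -/
def estTauL (P : PrmT) (du : ℕ) (r : List Bool) (jk : ℕ) : List ℕ :=
  (List.range du).map fun cc => scalarAt r P.e ((P.e + 1) * (P.N' * P.m) + jk * P.d + cc)

/-- `estTauL` on codes: context `((P, 1ᵈ), (r, jk))`. [cite: AroraBarak2009, §1.3] -/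
theorem codeFP_estTauL : CodeFP (pairE (pairE prmE unE) (pairE strE natE)) (rawE natE) (fun z => estTauL z.1.1 z.1.2 z.2.1 z.2.2) := by
  have hP : CodeFP (pairE (pairE (pairE prmE unE) (pairE strE natE)) natE) prmE (fun t => t.1.1.1) := (fst _ _).fst'.fst'
  have hcc : CodeFP (pairE (pairE (pairE prmE unE) (pairE strE natE)) natE) natE
      (fun t => scalarAt t.1.2.1 t.1.1.1.e ((t.1.1.1.e + 1) * (t.1.1.1.N' * t.1.1.1.m) + t.1.2.2 * t.1.1.1.d + t.2)) :=
    codeFP_scalarAt.comp ((fst _ _).snd'.fst'.pair ((codeFP_prm_e.comp hP).pair (natAdd.comp ((natAdd.comp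
      ((natMul.comp ((natAdd.comp ((codeFP_prm_e.comp hP).pair (const _ 1))).pair (natMul.comp ((codeFP_prm_N'.comp hP).pair
        (codeFP_prm_m.comp hP))))).pair (natMul.comp ((fst _ _).snd'.snd'.pair (codeFP_prm_d.comp hP))))).pair (snd _ _)))))
  exact ((map hcc).comp ((CodeFP.id _).pair ((rangeOf.comp ((fst _ _).snd'.pair (natOfUn.comp (fst _ _).snd'))).congr fun z => by
    show List.range (min z.1.2 z.1.2) = List.range z.1.2; rw [min_self]))).congr fun _ => rfl

/-- The call's coin slice. [cite: AroraBarak2009, Def. 7.1] -/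
def estCsL (P : PrmT) (r : List Bool) (jk : ℕ) : List Bool := strSliceAt r (numScalarsL P * P.e + jk * P.ℓ) P.ℓ

/-- `estCsL` on codes: context `(P, (r, jk))`. [cite: AroraBarak2009, §1.3] -/
theorem codeFP_estCsL : CodeFP (pairE prmE (pairE strE natE)) strE (fun z => estCsL z.1 z.2.1 z.2.2) := by
  have hℓ : CodeFP (pairE prmE (pairE strE natE)) natE (fun z => z.1.ℓ) := codeFP_prm_ℓ.comp (fst _ _)
  exact (codeFP_strSliceAt.comp ((snd _ _).fst'.pair ((natAdd.comp ((natMul.comp ((codeFP_numScalarsL.comp (fst _ _)).pair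
    (codeFP_prm_e.comp (fst _ _)))).pair (natMul.comp ((snd _ _).snd'.pair hℓ)))).pair hℓ))).congr fun _ => rfl

/-- **The estimation query of unit `(j, k)` at the list level** (with unary copies `du`, `Ku`, `eu` of
`d`, `K`, `e`): the data `(d, (Q, block))` of the shifted block of level-`j` items, and the call's coin
slice. [cite: MicciancioPeikert2012, Thm. 3.1 proof (p. 15)] -/
def estQueryL (P : PrmT) (du Ku eu : ℕ) (items : List LItem) (r : List Bool) (j k : ℕ) : LData × List Bool :=
  let jk := j * P.N' + k
  ((P.d, (P.Q, ((estGroups P Ku items jk).mapIdx fun i grp => estItemL P du r jk (genAt P eu j) i grp).map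
    (shiftItem P.Q (estTauL P du r jk)))), estCsL P r jk)

/-- The context of the estimation query: `((P, (1ᵈ, (1ᴷ, 1ᵉ))), (samples, (coins, (j, k))))`. [folklore] -/
abbrev EstCtx : Type := (PrmT × (ℕ × (ℕ × ℕ))) × (List LItem × (List Bool × (ℕ × ℕ)))

/-- Its code. [folklore] -/
abbrev estCtxE : EstCtx → List Bool := pairE (pairE prmE (pairE unE (pairE unE unE))) (pairE (rawE itemE) (pairE strE (pairE natE natE)))

set_option maxHeartbeats 800000 in
/-- **The estimation query on codes.** [cite: AroraBarak2009, §1.3] -/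
theorem codeFP_estQueryL : CodeFP estCtxE (pairE ldataE strE)
    (fun z : EstCtx => estQueryL z.1.1 z.1.2.1 z.1.2.2.1 z.1.2.2.2 z.2.1 z.2.2.1 z.2.2.2.1 z.2.2.2.2) := by
  have hP : CodeFP estCtxE prmE (fun z => z.1.1) := (fst _ _).fst'
  have hdu : CodeFP estCtxE unE (fun z => z.1.2.1) := (fst _ _).snd'.fst'
  have hKu : CodeFP estCtxE unE (fun z => z.1.2.2.1) := (fst _ _).snd'.snd'.fst'
  have heu : CodeFP estCtxE unE (fun z => z.1.2.2.2) := (fst _ _).snd'.snd'.snd'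
  have hitems : CodeFP estCtxE (rawE itemE) (fun z => z.2.1) := (snd _ _).fst'
  have hr : CodeFP estCtxE strE (fun z => z.2.2.1) := (snd _ _).snd'.fst'
  have hj : CodeFP estCtxE natE (fun z => z.2.2.2.1) := (snd _ _).snd'.snd'.fst'
  have hk : CodeFP estCtxE natE (fun z => z.2.2.2.2) := (snd _ _).snd'.snd'.snd'
  have hjk := natAdd.comp ((natMul.comp (hj.pair (codeFP_prm_N'.comp hP))).pair hk)
  have hgen := codeFP_genAt.comp ((hP.pair heu).pair hj)
  have hgrps := codeFP_estGroups.comp ((hP.pair hKu).pair (hitems.pair hjk))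
  -- the item map, context `((P, 1ᵈ), (r, (jk, gen)))`
  have hctx := (hP.pair hdu).pair (hr.pair (hjk.pair hgen))
  have hitemsL := (mapIdx codeFP_estItemL).comp (hctx.pair hgrps)
  have hτ := codeFP_estTauL.comp ((hP.pair hdu).pair (hr.pair hjk))
  have hQ := codeFP_prm_Q.comp hP
  have hblock := (map (codeFP_shiftItem.comp (((hQ.comp (fst _ _)).pair (hτ.comp (fst _ _))).pair (snd _ _)))).comp
    ((CodeFP.id estCtxE).pair hitemsL)
  have hcs := codeFP_estCsL.comp (hP.pair (hr.pair hjk))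
  exact (((codeFP_prm_d.comp hP).pair (hQ.pair ((listOfRaw itemE).comp hblock))).pair hcs).congr fun z => by
    obtain ⟨⟨P, du, Ku, eu⟩, items, r, j, k⟩ := z
    rfl

end Prog

end MP12

end LWE

end Literature.Computability.Cryptography
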